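import Mathlib
import HarnessLib
import Literature.Geometry.Lorentzian.TimelikeRayCauchy
import Literature.Geometry.Lorentzian.CauchyHypersurfaceCausalProofs
import Literature.Geometry.Lorentzian.CauchyHypersurfaceGlobalHyperbolicity
import Literature.Geometry.Lorentzian.CausalityPushUp

/-!
# S2 helper — the Cauchy obstruction to past-directed uniformly timelike rays
# (crux `StarvedNecks.NeckGapDecay`, stmt-FinalStateConjecture-16768, line `Sketch`, stub `stub_orientationAnchor`)

Generic time-oriented Lorentzian causality (no charts): a past-directed ray `γ|[0, ∞)` with
`g(γ', γ') ≤ −k < 0` cannot stay inside `J⁺(S)` of a Cauchy hypersurface `S`.  Read for the reversed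
orientation it is future endless, hence eventually in `J⁻(S)`; push-up from a later ray point in `J⁺(S)`
puts it in `I⁺(S)`, against `J⁻(S) ∩ I⁺(S) = ∅`.  Used by `stub_orientationAnchor` (file
`StarvedNecksNeckGapDecayStubOrientationAnchor.lean`) to exclude a past-directed label axis of the input
hole chart inside `O ⊆ J⁺(ιX)`.

References: B. O'Neill, *Semi-Riemannian geometry*, Academic Press 1983, Ch. 14, Cor. 14.1, Def. 14.28,
Lemma 14.29, Lemma 14.40.
-/

noncomputable section

open scoped Manifold ContDiff Topology ENNReal
open Filter Set MeasureTheory Topology Literature.Geometry.Lorentzian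

namespace Summit.FinalStateConjecture.FinalStateConjecture.Theorems.NeckGapDecay.ConnectionLevelCones.OrientationAnchorStub
set_option linter.dupNamespace false

/-! ## A past-directed uniformly timelike ray cannot stay in `J⁺` of a Cauchy hypersurface -/

section PastRay

variable {E : Type*} [NormedAddCommGroup E] [NormedSpace ℝ E] {H : Type*} [TopologicalSpace H]
  {I : ModelWithCorners ℝ E H} {n : ℕ∞ω} {M : Type*} [TopologicalSpace M] [ChartedSpace H M]
  [IsManifold I ∞ M]

/-- **No past-directed timelike ray with `g(γ', γ') ≤ -k < 0` stays in `J⁺(S)` for a Cauchy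
hypersurface `S`** (Hausdorff, second countable, finite-dimensional boundaryless model, `Cⁿ` metric,
`n ≥ 2`). Read for the reversed time orientation `-T`, the ray `γ|[0, ∞)` is a future timelike curve
which is future endless (`TimeOrientation.isFutureEndless_Ici_of_val_velocity_le`: the speed bound
forbids a limit point), hence eventually, from a parameter `s₀` on, in `J⁺_{-T}(S) = J⁻(S)`
(`IsCauchyHypersurface.exists_forall_mem_causalFuture_of_isFutureEndless` for the reversed Cauchy
hypersurface, `IsCauchyHypersurface.reverse`). On the other hand `γ (s₀ + 1) ∈ J⁺(S)` and
`γ (s₀ + 1) ≪ γ s₀` (along `γ|[s₀, s₀ + 1]`, read backwards), so `γ s₀ ∈ I⁺(S)` by push-up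
(O'Neill 1983, Ch. 14, Cor. 14.1); but `J⁻(S)` and `I⁺(S)` are disjoint for a Cauchy hypersurface
(O'Neill 1983, Ch. 14, Lemma 14.29; `IsCauchyHypersurface.disjoint_causalFuture_chronologicalPast`
for `-T`). [folklore] -/
theorem false_of_pastRay_subset_causalFuture [T2Space M] [SecondCountableTopology M]
    [I.Boundaryless] [FiniteDimensional ℝ E] {g : LorentzianMetric I n M}
    {τ : TimeOrientation g} (hn : 2 ≤ n) {S : Set M} (hS : g.IsCauchyHypersurface τ S)
    {γ : ℝ → M} {k : ℝ} (hk : 0 < k)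
    (hγ : ∀ s : ℝ, 0 ≤ s → MDifferentiableAt 𝓘(ℝ, ℝ) I γ s ∧
      g.val (γ s) (velocity I γ s) (velocity I γ s) ≤ -k ∧ τ.IsPastDirected (velocity I γ s))
    (hmem : ∀ s : ℝ, 0 ≤ s → γ s ∈ g.causalFuture τ S) : False := by
  -- adapted from `Summit.FinalStateConjecture.FinalStateConjecture.Theorems.RecurrentlyFlatDisperses.`
  -- `false_of_pastRay_subset_causalFuture` (ClusterCompletenessRecurrentlyFlatDispersesStubChartFuture):
  -- the Cauchy hypersurface replaces compactness + strong causality.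
  haveI : BoundarylessManifold I M := inferInstance
  have hn1 : (1 : ℕ∞ω) ≤ n := le_trans (by norm_num) hn
  -- `γ|[0, ∞)` is a future timelike curve for `-T`
  have hcurve : g.IsFutureTimelikeCurveOn τ.reverse γ (Ici 0) := fun t ht ↦
    ⟨(hγ t ht).1, lt_of_le_of_lt (hγ t ht).2.1 (by linarith),
      (TimeOrientation.isFutureDirected_reverse_iff _ _).mpr (hγ t ht).2.2⟩
  -- it is future endless (for `-T`)
  have hend : IsFutureEndless γ (Ici 0) :=
    τ.reverse.isFutureEndless_Ici_of_val_velocity_le hn1 hk fun s hs ↦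
      ⟨(hγ s hs).1, (hγ s hs).2.1,
        (TimeOrientation.isFutureDirected_reverse_iff _ _).mpr (hγ s hs).2.2⟩
  -- hence eventually in `J⁺_{-T}(S) = J⁻(S)`
  obtain ⟨s₀, hs₀, hJ⟩ :=
    hS.reverse.exists_forall_mem_causalFuture_of_isFutureEndless hn hcurve hend
  have hs₀' : (0 : ℝ) ≤ s₀ := hs₀
  have hq₀J : γ s₀ ∈ g.causalFuture τ.reverse S := hJ s₀ le_rfl
  -- `γ (s₀ + 1) ≪ γ s₀`, i.e. `γ s₀ ∈ I⁺(γ (s₀ + 1))`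
  have hq₁ : γ (s₀ + 1) ∈ g.chronologicalPast τ {γ s₀} :=
    ⟨γ s₀, rfl, γ, s₀, s₀ + 1, by linarith,
      hcurve.mono fun t ht ↦ mem_Ici.mpr (hs₀'.trans ht.1), rfl, rfl⟩
  have hq₀I : γ s₀ ∈ g.chronologicalFuture τ {γ (s₀ + 1)} :=
    LorentzianMetric.mem_chronologicalFuture_of_mem_chronologicalPast hq₁
  -- `γ (s₀ + 1) ∈ J⁺(S)`, so `γ s₀ ∈ I⁺(S)` by push-up
  have hq₁J : γ (s₀ + 1) ∈ g.causalFuture τ S := hmem (s₀ + 1) (by linarith)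
  rw [LorentzianMetric.causalFuture_eq_biUnion] at hq₁J
  simp only [mem_iUnion, exists_prop] at hq₁J
  obtain ⟨p, hpS, hq₁p⟩ := hq₁J
  have hq₀S : γ s₀ ∈ g.chronologicalFuture τ S :=
    LorentzianMetric.chronologicalFuture_mono (singleton_subset_iff.mpr hpS)
      (LorentzianMetric.mem_chronologicalFuture_of_mem_causalFuture hn1 hq₁p hq₀I)
  -- contradiction with `J⁻(S) ∩ I⁺(S) = ∅`
  have hdis := hS.reverse.disjoint_causalFuture_chronologicalPast hn
  rw [LorentzianMetric.chronologicalPast_reverse] at hdis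
  exact Set.disjoint_left.mp hdis hq₀J hq₀S

end PastRay

end Summit.FinalStateConjecture.FinalStateConjecture.Theorems.NeckGapDecay.ConnectionLevelCones.OrientationAnchorStub

end
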